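import Literature.Geometry.Lorentzian.InitialDataPullback
import Literature.Geometry.Lorentzian.EinsteinProofs
import Literature.Geometry.Riemannian.ChangGurskyYangProofs
import HarnessLib

/-!
# Homotheties of initial data sets: `(h, k) ↦ (c² h, c k)` preserves the vacuum constraints

The Einstein vacuum constraint equations are invariant under the constant rescaling
`(h, k) ↦ (c² h, c k)`, `c > 0`, of an initial data set — the data induced on the same slice by
the rescaled development `c² g` (with future unit normal `c⁻¹ ν`): the Levi-Civita connection of
`c² h` is that of `h` (Topping 2006, §1.2.3; tree: `PseudoRiemannianMetric.leviCivita_constSmul`),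
so `R(c² h) = c⁻² R(h)`, `|c k|²_{c² h} = c⁻² |k|²_h`, `tr_{c² h}(c k) = c⁻¹ tr_h k`,
`div_{c² h}(c k) = c⁻¹ div_h k`, whence
`(R − |k|² + (tr k)²)(c² h, c k) = c⁻² (R − |k|² + (tr k)²)(h, k)` and
`(div k − d tr k)(c² h, c k) = c⁻¹ (div k − d tr k)(h, k)` (Bartnik–Isenberg 2004, §2: the
constraint map is homogeneous under this scaling; this is the scaling used to place small / large
bodies in gluing constructions, e.g. Corvino–Schoen, Hintz 2022).

* `InitialDataSet.homothety D c hc` — the rescaled data set `(c² h, c k)` (metric through the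
  tree's `PseudoRiemannianMetric.constSmul`); `homothety_h_inner`, `homothety_k`,
  `homothety_metric`;
* `traceK_homothety`, `normSqK_homothety`, `covDeriv₂_homothety`, `divergence_homothety`,
  `hamiltonianConstraintFn_homothety`, `momentumConstraintFn_homothety_apply`;
* `isVacuumConstraintSolution_homothety_iff` — **`(c² h, c k)` solves the vacuum constraints iff
  `(h, k)` does**.

Everything is proved. Design: the metric-level facts (`leviCivita_constSmul`,
`scalarCurvature_constSmul`, `trace_constSmul`, `normSq_constSmul`) are imported from the
Riemannian topic (`ChangGurskyYangProofs.lean`, `MetricTraceScaling.lean`), where they were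
first needed; only the covariant differential of `k`, the divergence and the two constraint
functions are treated here.

## References

* R. Bartnik, J. Isenberg, *The constraint equations*, in: The Einstein equations and the large
  scale behavior of gravitational fields (2004), §2. [BartnikIsenberg2004]
* P. Topping, *Lectures on the Ricci flow*, LMS LNS 325 (2006), §1.2.3. [Topping2006]
* B. O'Neill, *Semi-Riemannian geometry* (1983), Ch. 3, Thm. 3.11, Def. 3.17, p. 86. [ONeill1983]
-/

noncomputable section

-- instance search through nested operator types (as in `ChartCurvature`, `ConstraintFamilies`)
set_option maxSynthPendingDepth 3

open Bundle Set Function Filter Manifold FiberBundle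
open scoped Manifold ContDiff Topology

namespace Literature.Geometry.Lorentzian

variable {E : Type*} [NormedAddCommGroup E] [NormedSpace ℝ E] {H : Type*} [TopologicalSpace H]
  {I : ModelWithCorners ℝ E H} {X : Type*} [TopologicalSpace X] [ChartedSpace H X]
  [IsManifold I ∞ X]

/-! ### The covariant differential and the divergence under constant rescaling of the metric -/

namespace PseudoRiemannianMetric

variable {n : ℕ∞ω} (g : PseudoRiemannianMetric I n E (TangentSpace I : X → Type _)) [g.HasLeviCivita]
  {a : ℝ} (ha : a ≠ 0) [(g.constSmul a ha).HasLeviCivita]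

/-- The bare covariant differential of a field of bilinear forms is the same for `a g` and `g`
(it involves the metric only through the Levi-Civita connection, `leviCivita_constSmul`).
[cite: ONeill1983, Ch. 3, Def. 3.17] -/
theorem covDeriv₂Aux_constSmul (k : Π x : X, TangentSpace I x →L[ℝ] TangentSpace I x →L[ℝ] ℝ)
    (U V W : Π x : X, TangentSpace I x) (x : X) :
    (g.constSmul a ha).covDeriv₂Aux k U V W x = g.covDeriv₂Aux k U V W x := by
  simp only [covDeriv₂Aux, Literature.Geometry.Lorentzian.PseudoRiemannianMetric.leviCivita_constSmul a ha]

/-- The bare covariant differential is homogeneous in the field: `∇(b k) = b ∇k` on vector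
fields (`d(b f) = b df` with Mathlib's junk conventions, `mvfderiv_const_mul`).
[cite: ONeill1983, Ch. 3, Def. 3.17] -/
theorem covDeriv₂Aux_const_smul (b : ℝ)
    (k : Π x : X, TangentSpace I x →L[ℝ] TangentSpace I x →L[ℝ] ℝ)
    (U V W : Π x : X, TangentSpace I x) (x : X) :
    g.covDeriv₂Aux (fun y ↦ b • k y) U V W x = b * g.covDeriv₂Aux k U V W x := by
  simp only [covDeriv₂Aux]
  have h1 : (fun y ↦ (b • k y) (U y) (V y)) = fun y ↦ b * k y (U y) (V y) := by
    funext y; rfl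
  rw [h1, mvfderiv_const_mul]
  simp only [FunLike.coe_smul, Pi.smul_apply, smul_eq_mul]
  ring

/-- `b • k` is differentiable where `k` is. [folklore] -/
theorem mdifferentiableAt_const_smul_bilin (b : ℝ)
    {k : Π x : X, TangentSpace I x →L[ℝ] TangentSpace I x →L[ℝ] ℝ} {x : X}
    (hk : MDifferentiableAt I (I.prod 𝓘(ℝ, E →L[ℝ] E →L[ℝ] ℝ))
      (fun y ↦ TotalSpace.mk' (E →L[ℝ] E →L[ℝ] ℝ)
        (E := fun y : X ↦ TangentSpace I y →L[ℝ] TangentSpace I y →L[ℝ] ℝ) y (k y)) x) :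
    MDifferentiableAt I (I.prod 𝓘(ℝ, E →L[ℝ] E →L[ℝ] ℝ))
      (fun y ↦ TotalSpace.mk' (E →L[ℝ] E →L[ℝ] ℝ)
        (E := fun y : X ↦ TangentSpace I y →L[ℝ] TangentSpace I y →L[ℝ] ℝ) y (b • k y)) x :=
  hk.smul_const_section (a := b)

variable [FiniteDimensional ℝ E]

/-- **The covariant differential `∇k` of a field of bilinear forms differentiable at `x` is the
same for `a g` and `g`** (both are determined by the bare differentials on extended vectors,
`covDeriv₂_apply_extend`). [cite: ONeill1983, Ch. 3, Def. 3.17] -/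
theorem covDeriv₂_constSmul {k : Π x : X, TangentSpace I x →L[ℝ] TangentSpace I x →L[ℝ] ℝ} {x : X}
    (hk : MDifferentiableAt I (I.prod 𝓘(ℝ, E →L[ℝ] E →L[ℝ] ℝ))
      (fun y ↦ TotalSpace.mk' (E →L[ℝ] E →L[ℝ] ℝ)
        (E := fun y : X ↦ TangentSpace I y →L[ℝ] TangentSpace I y →L[ℝ] ℝ) y (k y)) x)
    (U₀ V₀ W₀ : TangentSpace I x) :
    (g.constSmul a ha).covDeriv₂ k x U₀ V₀ W₀ = g.covDeriv₂ k x U₀ V₀ W₀ := by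
  rw [covDeriv₂_apply_extend hk, covDeriv₂_apply_extend hk, covDeriv₂Aux_constSmul]

/-- **`∇(b k) = b ∇k`** for a field of bilinear forms `k` differentiable at `x` (both sides are
the unique trilinear maps agreeing with the bare differentials on extended vectors,
`covDeriv₂_apply_extend`). [cite: ONeill1983, Ch. 3, Def. 3.17] -/
theorem covDeriv₂_const_smul (b : ℝ)
    {k : Π x : X, TangentSpace I x →L[ℝ] TangentSpace I x →L[ℝ] ℝ} {x : X}
    (hk : MDifferentiableAt I (I.prod 𝓘(ℝ, E →L[ℝ] E →L[ℝ] ℝ))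
      (fun y ↦ TotalSpace.mk' (E →L[ℝ] E →L[ℝ] ℝ)
        (E := fun y : X ↦ TangentSpace I y →L[ℝ] TangentSpace I y →L[ℝ] ℝ) y (k y)) x)
    (U₀ V₀ W₀ : TangentSpace I x) :
    g.covDeriv₂ (fun y ↦ b • k y) x U₀ V₀ W₀ = b * g.covDeriv₂ k x U₀ V₀ W₀ := by
  rw [covDeriv₂_apply_extend (mdifferentiableAt_const_smul_bilin b hk), covDeriv₂_apply_extend hk,
    covDeriv₂Aux_const_smul]

/-- **The divergence under rescaling**: `div_{a g}(b k) = a⁻¹ b div_g k` at a point where `k`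
is differentiable (`∇` is unchanged, the contraction picks up `a⁻¹`, `trace_constSmul`).
[cite: ONeill1983, Ch. 3, p. 86] -/
theorem divergence_constSmul_const_smul (b : ℝ)
    {k : Π x : X, TangentSpace I x →L[ℝ] TangentSpace I x →L[ℝ] ℝ} {x : X}
    (hk : MDifferentiableAt I (I.prod 𝓘(ℝ, E →L[ℝ] E →L[ℝ] ℝ))
      (fun y ↦ TotalSpace.mk' (E →L[ℝ] E →L[ℝ] ℝ)
        (E := fun y : X ↦ TangentSpace I y →L[ℝ] TangentSpace I y →L[ℝ] ℝ) y (k y)) x)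
    (V₀ : TangentSpace I x) :
    (g.constSmul a ha).divergence (fun y ↦ b • k y) x V₀ = a⁻¹ * b * g.divergence k x V₀ := by
  have haux : (g.constSmul a ha).divergenceAux (fun y ↦ b • k y) x V₀ = b • g.divergenceAux k x V₀ := by
    refine LinearMap.ext₂ fun U₀ W₀ ↦ ?_
    rw [divergenceAux_apply, LinearMap.smul_apply, LinearMap.smul_apply, divergenceAux_apply,
      g.covDeriv₂_constSmul ha (mdifferentiableAt_const_smul_bilin b hk), g.covDeriv₂_const_smul b hk]
    rfl
  rw [divergence_apply, divergence_apply, haux,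
    Literature.Geometry.Lorentzian.PseudoRiemannianMetric.trace_constSmul, trace_smul]
  ring

end PseudoRiemannianMetric

/-! ### The homothety of an initial data set -/

namespace InitialDataSet

variable [FiniteDimensional ℝ E]

/-- The unit ball of `c² h` at `x` is von Neumann bounded (positive definiteness on the
finite-dimensional fibre). [folklore] -/
theorem isVonNBounded_setOf_sq_mul_lt_one (D : InitialDataSet I X) (c : ℝ) (hc : 0 < c) (x : X) :
    Bornology.IsVonNBounded ℝ
      {v : E | (c ^ 2 • (show E →L[ℝ] E →L[ℝ] ℝ from D.h.inner x)) v v < 1} :=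
  PseudoRiemannianMetric.IsSpacelikeImmersion.isVonNBounded_setOf_lt_one_of_pos
    (V := E) (c ^ 2 • (show E →L[ℝ] E →L[ℝ] ℝ from D.h.inner x)) fun v hv ↦ by
      simp only [smul_apply, smul_eq_mul]
      exact mul_pos (pow_pos hc 2) (D.h.pos x v hv)

/-- **The homothety `(c² h, c k)` of an initial data set** (`c > 0`): the data induced on the same
slice by the rescaled development `c² g` (future unit normal `c⁻¹ ν`, so that
`K_{c⁻¹ν}^{c² g} = c K_ν^g`). Bartnik–Isenberg 2004, §2 (scaling of the constraint map).
[cite: BartnikIsenberg2004, §2] -/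
def homothety (D : InitialDataSet I X) (c : ℝ) (hc : 0 < c) : InitialDataSet I X where
  h :=
    { inner := fun x ↦ c ^ 2 • D.h.inner x
      symm := fun x v w ↦ by
        show c ^ 2 * D.h.inner x v w = c ^ 2 * D.h.inner x w v
        rw [D.h.symm x v w]
      pos := fun x v hv ↦ by
        show 0 < c ^ 2 * D.h.inner x v v
        exact mul_pos (pow_pos hc 2) (D.h.pos x v hv)
      isVonNBounded := fun x ↦ D.isVonNBounded_setOf_sq_mul_lt_one c hc x
      contMDiff := D.h.contMDiff.const_smul_section (a := c ^ 2) }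
  k x := c • D.k x
  k_symm x v w := by
    show c * D.k x v w = c * D.k x w v
    rw [D.k_symm x v w]
  contMDiff_k := D.contMDiff_k.const_smul_section (a := c)

omit [FiniteDimensional ℝ E] in
/-- `k` of any initial data set is differentiable (as a section of `Hom(TX, Hom(TX, ℝ))`).
[folklore] -/
theorem mdifferentiableAt_k (D : InitialDataSet I X) (x : X) :
    MDifferentiableAt I (I.prod 𝓘(ℝ, E →L[ℝ] E →L[ℝ] ℝ))
      (fun y ↦ TotalSpace.mk' (E →L[ℝ] E →L[ℝ] ℝ)
        (E := fun y : X ↦ TangentSpace I y →L[ℝ] TangentSpace I y →L[ℝ] ℝ) y (D.k y)) x :=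
  (D.contMDiff_k x).mdifferentiableAt (by simp)

variable (D : InitialDataSet I X) {c : ℝ} (hc : 0 < c)

/-- The metric of the homothety: `(c² h)_x (v, w) = c² h_x(v, w)`. [cite: BartnikIsenberg2004, §2] -/
@[simp]
theorem homothety_h_inner (x : X) (v w : TangentSpace I x) :
    (D.homothety c hc).h.inner x v w = c ^ 2 * D.h.inner x v w := rfl

/-- The metric of the homothety as a section: `(c² h)_x = c² • h_x`. [cite: BartnikIsenberg2004, §2] -/
theorem homothety_h_inner_eq (x : X) : (D.homothety c hc).h.inner x = c ^ 2 • D.h.inner x := rfl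

/-- The tensor `k` of the homothety: `(c k)_x (v, w) = c k_x(v, w)`. [cite: BartnikIsenberg2004, §2] -/
@[simp]
theorem homothety_k (x : X) (v w : TangentSpace I x) :
    (D.homothety c hc).k x v w = c * D.k x v w := rfl

/-- The tensor `k` of the homothety as a section: `(c k)_x = c • k_x`. [cite: BartnikIsenberg2004, §2] -/
theorem homothety_k_eq (x : X) : (D.homothety c hc).k x = c • D.k x := rfl

/-- **The metric of the homothety is the constant rescaling `c² • h`** (`constSmul`) of the metric
of `D`. [cite: BartnikIsenberg2004, §2] -/
theorem homothety_metric :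
    (D.homothety c hc).metric = D.metric.constSmul (c ^ 2) (pow_pos hc 2).ne' := by
  ext x v w
  rfl

/-- The homothety by `1` is the identity. [folklore] -/
theorem homothety_one : D.homothety 1 one_pos = D := by
  refine ext' (fun x v w ↦ ?_) (fun x v w ↦ ?_)
  · rw [homothety_h_inner, one_pow, one_mul]
  · rw [homothety_k, one_mul]

/-- Iterated homotheties compose: `(D.homothety c).homothety d = D.homothety (d c)`. [folklore] -/
theorem homothety_homothety {d : ℝ} (hd : 0 < d) :
    (D.homothety c hc).homothety d hd = D.homothety (d * c) (mul_pos hd hc) := by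
  refine ext' (fun x v w ↦ ?_) (fun x v w ↦ ?_)
  · simp only [homothety_h_inner]; ring
  · simp only [homothety_k]; ring

/-- `kBilin` of the homothety is `c • kBilin`. [folklore] -/
theorem kBilin_homothety (x : X) : (D.homothety c hc).kBilin x = c • D.kBilin x := by
  refine LinearMap.ext₂ fun v w ↦ ?_
  rfl

/-- `(c²)⁻¹ c = c⁻¹` for `c ≠ 0`. [folklore] -/
private theorem sq_inv_mul_self {c : ℝ} (hc : c ≠ 0) : (c ^ 2)⁻¹ * c = c⁻¹ := by
  rw [pow_two, mul_inv, mul_assoc, inv_mul_cancel₀ hc, mul_one]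

/-- **The mean curvature of the homothety**: `tr_{c² h}(c k) = c⁻¹ tr_h k`.
[cite: BartnikIsenberg2004, §2] -/
theorem traceK_homothety (x : X) : (D.homothety c hc).traceK x = c⁻¹ * D.traceK x := by
  rw [traceK, traceK, kBilin_homothety, homothety_metric,
    Literature.Geometry.Lorentzian.PseudoRiemannianMetric.trace_constSmul,
    PseudoRiemannianMetric.trace_smul, ← mul_assoc, sq_inv_mul_self hc.ne']

/-- `tr k` of the homothety as a function. [cite: BartnikIsenberg2004, §2] -/
theorem traceK_homothety_eq : (D.homothety c hc).traceK = fun x ↦ c⁻¹ * D.traceK x :=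
  funext (D.traceK_homothety hc)

/-- **The square norm of `k` of the homothety**: `|c k|²_{c² h} = c⁻² |k|²_h`.
[cite: BartnikIsenberg2004, §2] -/
theorem normSqK_homothety (x : X) : (D.homothety c hc).normSqK x = (c ^ 2)⁻¹ * D.normSqK x := by
  rw [normSqK, normSqK, kBilin_homothety, homothety_metric,
    Literature.Geometry.Lorentzian.PseudoRiemannianMetric.normSq_constSmul]
  have hsmul : ∀ (g : PseudoRiemannianMetric I ∞ E (TangentSpace I : X → Type _)) (b : ℝ)
      (T : LinearMap.BilinForm ℝ (TangentSpace I x)),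
      g.normSq x (b • T) = b ^ 2 * g.normSq x T := by
    intro g b T
    have hflip : (b • T).flip = b • T.flip := by
      refine LinearMap.ext₂ fun v w ↦ ?_
      rfl
    simp only [PseudoRiemannianMetric.normSq, hflip, LinearMap.comp_smul, LinearMap.smul_comp,
      smul_smul, LinearMap.map_smul, smul_eq_mul, sq]
  rw [hsmul]
  have hc' : c ≠ 0 := hc.ne'
  field_simp

section Constraints

variable [CompleteSpace E] [D.metric.HasLeviCivita] [(D.homothety c hc).metric.HasLeviCivita]

omit [CompleteSpace E] [D.metric.HasLeviCivita] in
/-- The rescaled metric `c² • h` has a Levi-Civita connection (instance plumbing for the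
`constSmul` form of the metric of the homothety). [folklore] -/
theorem hasLeviCivita_constSmul_of_homothety :
    (D.metric.constSmul (c ^ 2) (pow_pos hc 2).ne').HasLeviCivita := by
  rw [← homothety_metric]
  infer_instance

/-- **The scalar curvature of the homothety**: `R(c² h) = c⁻² R(h)`
(`scalarCurvature_constSmul`). [cite: Topping2006, §1.2.3] -/
theorem scalarCurvature_homothety (x : X) :
    (D.homothety c hc).metric.scalarCurvature x = (c ^ 2)⁻¹ * D.metric.scalarCurvature x := by
  haveI := D.hasLeviCivita_constSmul_of_homothety hc
  have key : ∀ (g' : PseudoRiemannianMetric I ∞ E (TangentSpace I : X → Type _)) [g'.HasLeviCivita],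
      g' = D.metric.constSmul (c ^ 2) (pow_pos hc 2).ne' →
      g'.scalarCurvature x = (c ^ 2)⁻¹ * D.metric.scalarCurvature x := by
    intro g' _ hg'
    subst hg'
    exact Literature.Geometry.Lorentzian.PseudoRiemannianMetric.scalarCurvature_constSmul _ _ x
  exact key _ (D.homothety_metric hc)

/-- **The Hamiltonian constraint function of the homothety**:
`(R − |k|² + (tr k)²)(c² h, c k) = c⁻² (R − |k|² + (tr k)²)(h, k)`. Bartnik–Isenberg 2004, §2.
[cite: BartnikIsenberg2004, §2] -/
theorem hamiltonianConstraintFn_homothety (x : X) :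
    (D.homothety c hc).hamiltonianConstraintFn x = (c ^ 2)⁻¹ * D.hamiltonianConstraintFn x := by
  rw [hamiltonianConstraintFn, hamiltonianConstraintFn, scalarCurvature_homothety,
    normSqK_homothety, traceK_homothety]
  have hc' : c ≠ 0 := hc.ne'
  field_simp

omit [CompleteSpace E] in
/-- **The divergence of `k` of the homothety**: `div_{c² h}(c k) = c⁻¹ div_h k`.
[cite: BartnikIsenberg2004, §2] -/
theorem divergence_homothety (x : X) (V₀ : TangentSpace I x) :
    (D.homothety c hc).metric.divergence (D.homothety c hc).k x V₀ =
      c⁻¹ * D.metric.divergence D.k x V₀ := by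
  haveI := D.hasLeviCivita_constSmul_of_homothety hc
  have hk : (D.homothety c hc).k = fun y ↦ c • D.k y := rfl
  have key : ∀ (g' : PseudoRiemannianMetric I ∞ E (TangentSpace I : X → Type _)) [g'.HasLeviCivita],
      g' = D.metric.constSmul (c ^ 2) (pow_pos hc 2).ne' →
      g'.divergence (fun y ↦ c • D.k y) x V₀ = c⁻¹ * D.metric.divergence D.k x V₀ := by
    intro g' _ hg'
    subst hg'
    rw [D.metric.divergence_constSmul_const_smul (pow_pos hc 2).ne' c (D.mdifferentiableAt_k x),
      sq_inv_mul_self hc.ne']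
  rw [hk]
  exact key _ (D.homothety_metric hc)

omit [CompleteSpace E] in
/-- **The momentum constraint covector of the homothety**:
`(div k − d tr k)(c² h, c k) = c⁻¹ (div k − d tr k)(h, k)`. Bartnik–Isenberg 2004, §2.
[cite: BartnikIsenberg2004, §2] -/
theorem momentumConstraintFn_homothety_apply (x : X) (V₀ : TangentSpace I x) :
    (D.homothety c hc).momentumConstraintFn x V₀ = c⁻¹ * D.momentumConstraintFn x V₀ := by
  rw [momentumConstraintFn_apply, momentumConstraintFn_apply, divergence_homothety,
    traceK_homothety_eq]
  change c⁻¹ * D.metric.divergence D.k x V₀ - mvfderiv I (fun y ↦ c⁻¹ * D.traceK y) x V₀ =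
    c⁻¹ * (D.metric.divergence D.k x V₀ - mvfderiv I D.traceK x V₀)
  rw [PseudoRiemannianMetric.mvfderiv_const_mul]
  simp only [FunLike.coe_smul, Pi.smul_apply, smul_eq_mul]
  ring

omit [CompleteSpace E] in
/-- The momentum constraint covector of the homothety is `c⁻¹` times that of `D`.
[cite: BartnikIsenberg2004, §2] -/
theorem momentumConstraintFn_homothety (x : X) :
    (D.homothety c hc).momentumConstraintFn x = c⁻¹ • D.momentumConstraintFn x :=
  LinearMap.ext fun V₀ ↦ by
    rw [momentumConstraintFn_homothety_apply, LinearMap.smul_apply, smul_eq_mul]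

/-- **The vacuum constraints are invariant under homotheties**: `(c² h, c k)` solves the vacuum
constraint equations iff `(h, k)` does. Bartnik–Isenberg 2004, §2. [cite: BartnikIsenberg2004, §2] -/
theorem isVacuumConstraintSolution_homothety_iff :
    (D.homothety c hc).IsVacuumConstraintSolution ↔ D.IsVacuumConstraintSolution := by
  have hc2 : (c ^ 2)⁻¹ ≠ 0 := inv_ne_zero (pow_pos hc 2).ne'
  have hc1 : c⁻¹ ≠ 0 := inv_ne_zero hc.ne'
  refine ⟨fun h x ↦ ?_, fun h x ↦ ?_⟩
  · obtain ⟨h1, h2⟩ := h x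
    rw [hamiltonianConstraintFn_homothety] at h1
    rw [momentumConstraintFn_homothety] at h2
    exact ⟨(mul_eq_zero.1 h1).resolve_left hc2, (smul_eq_zero.1 h2).resolve_left hc1⟩
  · obtain ⟨h1, h2⟩ := h x
    refine ⟨?_, ?_⟩
    · rw [hamiltonianConstraintFn_homothety, h1, mul_zero]
    · rw [momentumConstraintFn_homothety, h2, smul_zero]

/-- Homotheties of vacuum data are vacuum data. [cite: BartnikIsenberg2004, §2] -/
theorem IsVacuumConstraintSolution.homothety (h : D.IsVacuumConstraintSolution) :
    (D.homothety c hc).IsVacuumConstraintSolution :=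
  (D.isVacuumConstraintSolution_homothety_iff hc).2 h

end Constraints

end InitialDataSet

end Literature.Geometry.Lorentzian

end
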